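import Literature.Probability.RandomPlanarGeometry.CurveTortuosity

/-!
# drefute note on S5 (`SocketPinchBound`): three separate traversals already force a re-visit

Deterministic event reduction behind the S5 briefing: `HasTraversals 3 x r R` with `r < R`
(a fortiori `HasTraversals 4`) forces two visits of `B̄(x, r)` separated by an excursion beyond
radius `R` — the two-strand (polymer 4-leg) annulus event at `x` from scale `r` to `R`. So the fixed
threshold `4` of S5 could equally be `3`, and a bound on the re-visit probability is exactly what S5
asks. (Conversely a single visit supports at most two separate traversals.)
-/

noncomputable section

open Set Metric
open scoped unitInterval

namespace Literature.Probability.RandomPlanarGeometry.Curve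

variable {E : Type*} [PseudoMetricSpace E]

/-- **Three separate traversals of a genuine shell force a re-visit**: there are times
`p < q < p'` with `γ p` and `γ p'` in the small closed ball and `γ q` outside the large open ball. -/
theorem exists_revisit_of_hasTraversals_three {γ : Curve E} {x : E} {r R : ℝ} (hrR : r < R)
    (h : γ.HasTraversals 3 x r R) :
    ∃ p q p' : I, p < q ∧ q < p' ∧ dist (γ p) x ≤ r ∧ R ≤ dist (γ q) x ∧ dist (γ p') x ≤ r := by
  obtain ⟨s, t, hst, hsep⟩ := h
  have h01 : t 0 < s 1 := hsep (by decide)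
  have h12 : t 1 < s 2 := hsep (by decide)
  have hlt0 : s 0 < t 0 := (hst 0).lt hrR
  have hlt1 : s 1 < t 1 := (hst 1).lt hrR
  have hle2 : s 2 ≤ t 2 := (hst 2).1
  rcases (hst 1).2 with ⟨hs1, ht1⟩ | ⟨hs1, ht1⟩
  · -- middle traversal is inward → outward: `p = s 1`, `q = t 1`, `p'` = small end of the third
    rcases (hst 2).2 with ⟨hs2, _⟩ | ⟨_, ht2⟩
    · exact ⟨s 1, t 1, s 2, hlt1, h12, hs1, ht1, hs2⟩
    · exact ⟨s 1, t 1, t 2, hlt1, h12.trans_le hle2, hs1, ht1, ht2⟩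
  · -- middle traversal is outward → inward: `p` = small end of the first, `q = s 1`, `p' = t 1`
    rcases (hst 0).2 with ⟨hs0, _⟩ | ⟨_, ht0⟩
    · exact ⟨s 0, s 1, t 1, hlt0.trans h01, hlt1, hs0, hs1, ht1⟩
    · exact ⟨t 0, s 1, t 1, h01, hlt1, ht0, hs1, ht1⟩

/-- **A fortiori for the threshold `4` of S5.** -/
theorem exists_revisit_of_hasTraversals_four {γ : Curve E} {x : E} {r R : ℝ} (hrR : r < R)
    (h : γ.HasTraversals 4 x r R) :
    ∃ p q p' : I, p < q ∧ q < p' ∧ dist (γ p) x ≤ r ∧ R ≤ dist (γ q) x ∧ dist (γ p') x ≤ r :=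
  exists_revisit_of_hasTraversals_three hrR (h.of_le (by norm_num))

end Literature.Probability.RandomPlanarGeometry.Curve

end
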